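import Literature.MathematicalPhysics.QuantumFieldTheory.Balaban1983to89.StepInhabited
import Literature.MathematicalPhysics.QuantumFieldTheory.Balaban1983to89.B14Sect1Repr

/-!
# `Balaban1983to89.B14Eq02Iterate` — CMP 119 (0.2) p. 244, `ρ_k = 𝐑Tρ_{k−1} = (𝐑T)^kρ₀`, WITH BODY: the sequence of
# effective densities DEFINED by iterating the renormalization transformation `T` (0.1) and the operation `𝐑` from the
# Wilson start `ρ₀ = exp[−(1/g₀²)A − E]`, on the cell's density carriers (`Setup.RTOpI`, `Step.DensityRGI`); both printed
# forms of (0.2) and the uniqueness of the trajectory PROVED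

statement-level skeleton of published theorems with citation tags; proofs where landed; nothing here is a claim about the Yang–Mills mass gap

CITATION HEADER (lean-in-tree rule).  Source: T. Bałaban, *Convergent renormalization expansions for lattice gauge
theories*, Commun. Math. Phys. **119**, 243–285 (1988), doi:10.1007/bf01217741 [Balaban1988Convergent] (cell paper
B14 = «[III]»; held `paper:balaban1988-cmp119-convergent-renormalization`, journal page = PDF page + 242; pp. 243–244 read
on the text layer `p0001`–`p0002` and the x2 render `…-p002-x2.png`).  Mega-formalization `lit-balaban`, unit
`lit-balaban-r11` (CMP 119, B14 fold owner), SKELETON row **B14.Eq0.2** (rows B14.Eq0.1 = (0.1) the transformation `T`,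
B14.Def@244R = the ASSUMED operation `𝐑`).

THE PRINTED TEXT (pp. 243–244 [PDF 1–2], verbatim).  *"We have to apply an additional operation after each renormalization
transformation T. This operation is denoted by 𝐑, and it changes effective densities on large field regions. Thus, we
construct a sequence of effective densities {ρ_k} by applying successively the operations 𝐑T to the initial density
ρ₀ = exp[−(1/g₀²)A − E], where A is the Wilson action, and E is a normalization constant. We have
  ρ_k = 𝐑Tρ_{k−1} = (𝐑T)^kρ₀,   (0.2)
and we finish the inductive procedure when we reach the unit lattice."*  And p. 244: *"The operation 𝐑 serves this
purpose. We will not describe it here, we will only assume that it has some properties incorporated in the inductive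
description of the effective actions."*

THE CARRIERS OF RECORD (pre-existing, BY NAME).  `Density P k G` = functions of the gauge field on `T^{(k)}`; the
renormalization transformations `T_k : Density P k G → Density P (k+1) G` as operators in the INHABITED carrier `Setup.RTOpI`
((0.1) in the cell's push-forward reading, DIVERGENCE F7/F17 — row B14.Eq0.1); the operations `𝐑_k : Density P (k+1) G →
Density P (k+1) G` as LETTERS (print assumes 𝐑, p. 244 — row B14.Def@244R); the Wilson start `B14.Sect1Repr.rho0 g₀ E =
exp[−(1/g₀²)A − E]` (`A = Setup.wilsonAction4`); the trajectory structure `Step.DensityRGI` (fields `ρ`, `T`, `R`, step law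
`ρ_{k+1} = 𝐑_k(T_kρ_k)`), in which the pre-cell typing carried (0.2) AS A FIELD of a datum.

WHAT IS TYPED / PROVED (0 `sorry`, no `Prop`-valued `def`).
§1  **(0.2) WITH BODY**: `rho T R ρ₀ k := ρ_k`, by recursion `ρ₀`, `ρ_{k+1} = 𝐑_k(T_kρ_k)`; `rho_zero`, **`rho_succ`** (the first
    printed form `ρ_k = 𝐑Tρ_{k−1}`); the composite `RT T R k = 𝐑_kT_k` and its `k`-fold iterate `RTpow T R k = (𝐑T)^k` from
    level `0` to level `k`; **`rho_eq_RTpow`** (the second printed form `ρ_k = (𝐑T)^kρ₀`, PROVED by induction); `rho_unit` (the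
    density on the unit lattice `T₁ = T^{(K)}`, `K = Setup.Params.K`: *"we finish the inductive procedure when we reach the unit
    lattice"*).
§2  The trajectory IS a `Step.DensityRGI` (`densityRGI T R ρ₀`, step law `rfl`), a Wilson start for `ρ₀ = rho0 g₀ E`
    (`densityRGI_isWilsonStart`); and (0.2) DETERMINES the sequence: **`ρ_eq_rho`** / `ρ_eq_RTpow` — every `DensityRGI` (and, via
    `Step.DensityRG.toI`, every `DensityRG`) trajectory equals `(𝐑T)^k` applied to its own start; `ρ_eq_of_start_eq` (two
    trajectories with the same `T`, `𝐑`, `ρ₀` coincide).  The free trajectory of `StepInhabited` is the case `𝐑 = id`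
    (`free_ρ_eq_rho`).

NOT ASSERTED: anything about `𝐑` beyond its type (rows B14.Def@244R, B15/B16), the form (0.1) of `T` beyond `RTOpI`, or
Theorem 1.

## References
* [Balaban1988Convergent] T. Bałaban, Commun. Math. Phys. 119 (1988) 243–285, (0.1)–(0.2) pp. 243–244.
-/

noncomputable section

namespace Literature.MathematicalPhysics.QuantumFieldTheory.Balaban1983to89.B14.Eq02Iterate

open Literature.MathematicalPhysics.QuantumFieldTheory.Balaban1983to89
open Step B14.Sect1Repr

variable {P : Params} {G : Type*} [GaugeGroup G] [MeasurableSpace G] [HaarData G] {av : ∀ j, Averaging P j G}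

/-! ## §1  (0.2) WITH BODY -/

/-- **(0.2)** p. 244 [PDF 2], verbatim: *"we construct a sequence of effective densities {ρ_k} by applying successively the
operations 𝐑T to the initial density ρ₀ … ρ_k = 𝐑Tρ_{k−1} = (𝐑T)^kρ₀, (0.2)"* — the sequence DEFINED by recursion from the
renormalization transformations `T_k` ((0.1), `Setup.RTOpI`), the operations `𝐑_k` (assumed letters, p. 244) and the start `ρ₀`.
[cite: Balaban1988Convergent, (0.2) p.244] -/
def rho (T : ∀ k, RTOpI P k G (av k)) (R : ∀ k, Density P (k + 1) G → Density P (k + 1) G) (ρ₀ : Density P 0 G) :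
    (k : ℕ) → Density P k G
  | 0 => ρ₀
  | k + 1 => R k ((T k).T (rho T R ρ₀ k))

variable (T : ∀ k, RTOpI P k G (av k)) (R : ∀ k, Density P (k + 1) G → Density P (k + 1) G) (ρ₀ : Density P 0 G)

/-- The sequence starts at `ρ₀`. [cite: Balaban1988Convergent, (0.2) p.244] -/
@[simp] theorem rho_zero : rho T R ρ₀ 0 = ρ₀ := rfl

/-- **(0.2), first form**: `ρ_k = 𝐑Tρ_{k−1}` (here `ρ_{k+1} = 𝐑_k(T_kρ_k)`). [cite: Balaban1988Convergent, (0.2) p.244] -/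
theorem rho_succ (k : ℕ) : rho T R ρ₀ (k + 1) = R k ((T k).T (rho T R ρ₀ k)) := rfl

/-- The composite operation `𝐑T` at level `k`: `ρ ↦ 𝐑_k(T_kρ)`, from densities on `T^{(k)}` to densities on `T^{(k+1)}`.
[cite: Balaban1988Convergent, (0.2) p.244] -/
def RT (k : ℕ) : Density P k G → Density P (k + 1) G := fun ρ => R k ((T k).T ρ)

/-- `(𝐑T)^k`: the `k`-fold composite `𝐑_{k−1}T_{k−1} ∘ ⋯ ∘ 𝐑₀T₀` from densities on the finest lattice `T^{(0)}` to densities on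
`T^{(k)}`. [cite: Balaban1988Convergent, (0.2) p.244] -/
def RTpow : (k : ℕ) → Density P 0 G → Density P k G
  | 0 => id
  | k + 1 => RT T R k ∘ RTpow k

/-- `(𝐑T)⁰ = id`. [cite: Balaban1988Convergent, (0.2) p.244] -/
@[simp] theorem RTpow_zero : RTpow T R 0 = id := rfl

/-- `(𝐑T)^{k+1} = 𝐑_kT_k ∘ (𝐑T)^k`. [cite: Balaban1988Convergent, (0.2) p.244] -/
theorem RTpow_succ (k : ℕ) : RTpow T R (k + 1) = RT T R k ∘ RTpow T R k := rfl

/-- **(0.2), second form**: `ρ_k = (𝐑T)^kρ₀`, PROVED from the recursion (induction on `k`). [cite: Balaban1988Convergent, (0.2) p.244] -/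
theorem rho_eq_RTpow : ∀ k : ℕ, rho T R ρ₀ k = RTpow T R k ρ₀
  | 0 => rfl
  | k + 1 => by rw [rho_succ, RTpow_succ, Function.comp_apply, ← rho_eq_RTpow k]; rfl

/-- Both printed forms at once: `ρ_k = 𝐑Tρ_{k−1} = (𝐑T)^kρ₀` (for `k ≥ 1`, written at `k + 1`).
[cite: Balaban1988Convergent, (0.2) p.244] -/
theorem eq02 (k : ℕ) :
    rho T R ρ₀ (k + 1) = RT T R k (rho T R ρ₀ k) ∧ rho T R ρ₀ (k + 1) = RTpow T R (k + 1) ρ₀ :=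
  ⟨rfl, rho_eq_RTpow T R ρ₀ (k + 1)⟩

/-- *"and we finish the inductive procedure when we reach the unit lattice"*: the last density of the procedure is `ρ_K` on the
unit lattice `T₁ = T^{(K)}`, `K = Setup.Params.K` the number of steps (`ε = L^{−K}`); it is `(𝐑T)^Kρ₀`.
[cite: Balaban1988Convergent, (0.2) p.244] -/
theorem rho_unit : rho T R ρ₀ P.K = RTpow T R P.K ρ₀ := rho_eq_RTpow T R ρ₀ P.K

/-! ## §2  The trajectory as a `Step.DensityRGI`; (0.2) determines the sequence -/

/-- The sequence (0.2) together with its `T`, `𝐑` IS a trajectory of the cell's inhabited carrier `Step.DensityRGI` (step law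
`ρ_{k+1} = 𝐑_k(T_kρ_k)` by `rfl`). [cite: Balaban1988Convergent, (0.2) p.244] -/
def densityRGI : DensityRGI P G av where
  ρ := rho T R ρ₀
  T := T
  R := R
  step := fun _ => rfl

/-- The trajectory's densities are the sequence (0.2). [cite: Balaban1988Convergent, (0.2) p.244] -/
@[simp] theorem densityRGI_ρ : (densityRGI T R ρ₀).ρ = rho T R ρ₀ := rfl

/-- With the Wilson start `ρ₀ = exp[−(1/g₀²)A − E]` (p. 243; `B14.Sect1Repr.rho0`) the trajectory is a Wilson start in the
sense of `Step.DensityRGI.IsWilsonStart`. [cite: Balaban1988Convergent, (0.2) p.244] -/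
theorem densityRGI_isWilsonStart (g₀ E : ℝ) : (densityRGI T R (rho0 (P := P) g₀ E)).IsWilsonStart g₀ E :=
  fun _ => rfl

omit T R ρ₀ in
/-- **(0.2) determines the sequence**: every trajectory of the carrier `Step.DensityRGI` IS `(𝐑T)^k` applied to its own start —
`ρ_k = rho T 𝐑 ρ₀ k` with the trajectory's `T`, `𝐑`, `ρ₀` (induction on the step law). [cite: Balaban1988Convergent, (0.2) p.244] -/
theorem ρ_eq_rho (D : DensityRGI P G av) : ∀ k : ℕ, D.ρ k = rho D.T D.R (D.ρ 0) k
  | 0 => rfl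
  | k + 1 => by rw [D.step k, rho_succ, ρ_eq_rho D k]

omit T R ρ₀ in
/-- The same in the form `ρ_k = (𝐑T)^kρ₀`. [cite: Balaban1988Convergent, (0.2) p.244] -/
theorem ρ_eq_RTpow (D : DensityRGI P G av) (k : ℕ) : D.ρ k = RTpow D.T D.R k (D.ρ 0) := by
  rw [ρ_eq_rho D k, rho_eq_RTpow]

omit T R ρ₀ in
/-- Uniqueness of the trajectory: two `DensityRGI` trajectories with the same transformations `T`, the same operations `𝐑` and
the same start `ρ₀` have the same densities at every step. [cite: Balaban1988Convergent, (0.2) p.244] -/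
theorem ρ_eq_of_start_eq (D D' : DensityRGI P G av) (hT : D.T = D'.T) (hR : D.R = D'.R) (h0 : D.ρ 0 = D'.ρ 0)
    (k : ℕ) : D.ρ k = D'.ρ k := by
  rw [ρ_eq_rho D k, ρ_eq_rho D' k, hT, hR, h0]

omit T R ρ₀ in
/-- The pre-cell carrier `Step.DensityRG` (renormalization transformations in `Setup.RTOp`) likewise: its densities are (0.2)
applied to its start (through `Step.DensityRG.toI`). [cite: Balaban1988Convergent, (0.2) p.244] -/
theorem densityRG_ρ_eq_rho (D : DensityRG P G av) (k : ℕ) :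
    D.ρ k = rho (fun j => (D.T j).toRTOpI) D.R (D.ρ 0) k :=
  ρ_eq_rho D.toI k

omit R in
/-- The free trajectory of `StepInhabited` (no 𝐑 applied — the small-field approximation) is (0.2) with `𝐑_k = id`.
[cite: Balaban1988Convergent, (0.2) p.244] -/
theorem free_ρ_eq_rho (k : ℕ) : (DensityRGI.free T ρ₀).ρ k = rho T (fun _ => id) ρ₀ k :=
  ρ_eq_rho (DensityRGI.free T ρ₀) k

end Literature.MathematicalPhysics.QuantumFieldTheory.Balaban1983to89.B14.Eq02Iterate
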